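import Summits.CriticalPhenomena.PercolationContinuityZ3.Theorems.Transplant.FKConnectivityAllQPat3CornerCone
import HarnessLib

/-!
# Connectivity correlation inequalities for `φ_{w,q}`, every `q > 0` — the 1-CUT reduction (Stage S3, part 3): census g32's
# `c1` step (unmarked cut vertex, marks `2∣1`) as a product-cone lemma with validity hypotheses

Definitions + theorems file (`--supports stmt-CriticalPhenomena-4575`), census lane `prim-bschramm-census` (gen 36) of the post-continuity programme (LANE 2 bschramm, FK sub-lane);
builds on p205010 (kernel theorem, internal audit signed; external expert review pending).
No named facts, no sorries; standard axioms.  `G = A ∪ B` meeting in ONE unmarked vertex `w`, marks `x, s ∈ A`, `y ∈ B`: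
`FK.tval_union2_cut1` (S1's `FK.pat3_union_serR` + fk-2's `FK.apExp_series`; the two-mark side is read on `(w, y, y)` so that
its only bit `w ~ y` is a `Pat3` coordinate), `FK.bitTab`, `FK.bitMix` / `FK.lev2_bitTab_nonneg`, `FK.lev2_bitMix_nonneg` (its generators), `FK.joinR3`/`FK.corrR3`,
`FK.hdec_cut1`, **`FK.cut1_level_nonneg_of_symCert`** (three-piece embedding with an empty third piece, as in
`…Pat3CornerCone`; the generators' validity on `A` is a HYPOTHESIS — the induction hypothesis of THEOREM 3C —, on `B` and the
empty piece it is coefficientwise).  Data files (certificates with ≤ 2 products, g32 §4) follow the CORNER recipe with `joinR3`.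
[cite: AyyerLinussonRavichandran2025, §7 eq. (13)–(15) (p. 22)] [cite: Grimmett2006, §3.8 (pp. 61–62)]
-/

noncomputable section

namespace Summit.CriticalPhenomena.PercolationContinuityZ3.Theorems

namespace FK

open SimpleGraph Literature.Probability.LatticeModels Literature.Probability.Percolation

/-! ### The 1-CUT configuration (census g32 §4, cut vertex unmarked, marks `2∣1`): `A ∋ x, s` and `B ∋ y` meeting in `{w}` -/

/-- The bit indicator tables of a two-mark side encoded as `pat3 γ w y y` (only the `xy` bit is read): `1{P.xy = β, Q.xy = β'}`
at level `0`. [folklore] -/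
def bitTab (β β' : Bool) : ℕ → Pat3 → Pat3 → ℤ :=
  fun c P Q => if c = 0 ∧ P.xy = β ∧ Q.xy = β' then 1 else 0

/-- The mixed bit indicator of a two-mark side: `1{P.xy ≠ Q.xy}` at level `0` (the flip-symmetric companion of
`bitTab true true`, `bitTab false false`). [folklore] -/
def bitMix : ℕ → Pat3 → Pat3 → ℤ :=
  fun c P Q => if c = 0 ∧ P.xy ≠ Q.xy then 1 else 0

/-- 1-CUT join read as a three-piece law: the series join of the first piece's pattern on `(x, w, s)` with the second piece's
bit `w ~ y` (read off its pattern on `(w, y, y)`); the (empty) third piece is ignored. [folklore] -/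
def joinR3 (P1 P2 _P3 : Pat3) : Pat3 := joinSerR P2.xy P1

/-- The 1-CUT gluing has no level correction. [folklore] -/
def corrR3 (_P1 _P2 _P3 : Pat3) : ℕ := 0

/-- The 1-CUT correction is at most `2`. [folklore] -/
theorem corrR3_le_two : ∀ P1 P2 P3 : Pat3, corrR3 P1 P2 P3 ≤ 2 := fun _ _ _ => by unfold corrR3; omega

section CutOne

open scoped Classical

variable {V : Type*} [Fintype V] {E₁ E₂ : Finset (Sym2 V)} {V₁ V₂ : Set V} {w : V}

/-- **BILINEAR DECOMPOSITION OF `tval` OVER A 1-CUT** (series gluing at the unmarked vertex `w`; marks `x, s` on the first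
side, `y` on the second; composite read on `(x, y, s)`): S1's `FK.pat3_union_serR` with fk-2's `FK.apExp_series`. [folklore] -/
theorem tval_union2_cut1 (hd : Disjoint E₁ E₂) (h₁ : ∀ e ∈ (↑E₁ : Set (Sym2 V)), ∀ z ∈ e, z ∈ V₁)
    (h₂ : ∀ e ∈ (↑E₂ : Set (Sym2 V)), ∀ z ∈ e, z ∈ V₂) (hS : V₁ ∩ V₂ ⊆ ({w} : Set V)) {x y s : V} (hxV : x ∉ V₂)
    (hsV : s ∉ V₂) (hyV : y ∉ V₁) (hxw : x ≠ w) (hyw : y ≠ w) (hxy : x ≠ y) (hsw : s ≠ w) (hsy : s ≠ y)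
    (wt : ℕ → ℝ) (tab : Pat3 → Pat3 → ℤ) :
    tval (fun n => wt (n + 2 * Fintype.card V)) (E₁ ∪ E₂) x y s tab =
      ∑ γ₁ ∈ E₁.powerset, ∑ γ₂ ∈ E₂.powerset,
        wt (apExp E₁ γ₁ + apExp E₂ γ₂) *
          (tab (joinSerR (pat3 γ₂ w y y).xy (pat3 γ₁ x w s)) (joinSerR (pat3 (E₂ \ γ₂) w y y).xy (pat3 (E₁ \ γ₁) x w s)) : ℝ) := by
  unfold tval
  beta_reduce
  rw [sum_powerset_union_disj hd]
  refine Finset.sum_congr rfl fun γ₁ hγ₁ => Finset.sum_congr rfl fun γ₂ hγ₂ => ?_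
  have g₁ := Finset.mem_powerset.1 hγ₁
  have g₂ := Finset.mem_powerset.1 hγ₂
  rw [union_sdiff_union hd g₁ g₂, apExp_series hd h₁ h₂ hS le_rfl le_rfl g₁ g₂,
    pat3_union_serR h₁ h₂ hS hxV hsV hyV hxw hyw hxy hsw hsy g₁ g₂,
    pat3_union_serR h₁ h₂ hS hxV hsV hyV hxw hyw hxy hsw hsy Finset.sdiff_subset Finset.sdiff_subset, pat3_xy, pat3_xy]

/-- The 1-CUT decomposition in the three-piece shape consumed by `FK.cone3_level_nonneg_sym` (second piece read on `(w, y, y)`,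
empty third piece, offset `4|V|`). [folklore] -/
theorem hdec_cut1 (hd : Disjoint E₁ E₂) (h₁ : ∀ e ∈ (↑E₁ : Set (Sym2 V)), ∀ z ∈ e, z ∈ V₁)
    (h₂ : ∀ e ∈ (↑E₂ : Set (Sym2 V)), ∀ z ∈ e, z ∈ V₂) (hS : V₁ ∩ V₂ ⊆ ({w} : Set V)) {x y s : V} (hxV : x ∉ V₂)
    (hsV : s ∉ V₂) (hyV : y ∉ V₁) (hxw : x ≠ w) (hyw : y ≠ w) (hxy : x ≠ y) (hsw : s ≠ w) (hsy : s ≠ y)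
    (wt : ℕ → ℝ) (tab : Pat3 → Pat3 → ℤ) :
    tval (fun n => wt (n + 4 * Fintype.card V)) (E₁ ∪ E₂) x y s tab =
      ∑ γ₁ ∈ E₁.powerset, ∑ γ₂ ∈ E₂.powerset, ∑ γ₃ ∈ (∅ : Finset (Sym2 V)).powerset,
        wt (apExp E₁ γ₁ + apExp E₂ γ₂ + apExp ∅ γ₃ + corrR3 (pat3 γ₁ x w s) (pat3 γ₂ w y y) (pat3 γ₃ x w s) +
            corrR3 (pat3 (E₁ \ γ₁) x w s) (pat3 (E₂ \ γ₂) w y y) (pat3 (∅ \ γ₃) x w s)) *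
          (tab (joinR3 (pat3 γ₁ x w s) (pat3 γ₂ w y y) (pat3 γ₃ x w s))
            (joinR3 (pat3 (E₁ \ γ₁) x w s) (pat3 (E₂ \ γ₂) w y y) (pat3 (∅ \ γ₃) x w s)) : ℝ) := by
  have h2 := tval_union2_cut1 hd h₁ h₂ hS hxV hsV hyV hxw hyw hxy hsw hsy (fun m => wt (m + 2 * Fintype.card V)) tab
  beta_reduce at h2
  have e : (fun n => wt (n + 4 * Fintype.card V)) = fun n => wt (n + 2 * Fintype.card V + 2 * Fintype.card V) := by
    funext n
    congr 1
    ring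
  rw [e, h2]
  refine Finset.sum_congr rfl fun γ₁ _ => Finset.sum_congr rfl fun γ₂ _ => ?_
  simp only [Finset.powerset_empty, Finset.sum_singleton, apExp_empty, joinR3, corrR3, add_zero]

/-- **The 1-CUT product-cone lemma with validity HYPOTHESES** (census g32's c1 reductions as a kernel statement): for
`G = A ∪ B` meeting in the single unmarked vertex `w`, marks `x, s` on `A`, `y` on `B`, a target `T` on `(x, y, s)`, a
product family dominated (after symmetrisation) through `joinR3`/`corrR3`, whose generators are levelwise nonnegative — on `A`
read on `(x, w, s)` (ASSUMED: the induction hypothesis of THEOREM 3C), on `B` read on `(w, y, y)` (e.g. `FK.bitTab`, nonnegative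
coefficientwise), on the empty piece (e.g. `FK.one2`) —: `0 ≤ D · lev2 G x y s T λ` at every level.
[cite: AyyerLinussonRavichandran2025, §7 (p. 22)] -/
theorem cut1_level_nonneg_of_symCert (hd : Disjoint E₁ E₂) (h₁ : ∀ e ∈ (↑E₁ : Set (Sym2 V)), ∀ z ∈ e, z ∈ V₁)
    (h₂ : ∀ e ∈ (↑E₂ : Set (Sym2 V)), ∀ z ∈ e, z ∈ V₂) (hS : V₁ ∩ V₂ ⊆ ({w} : Set V)) {x y s : V} (hxV : x ∉ V₂)
    (hsV : s ∉ V₂) (hyV : y ∉ V₁) (hxw : x ≠ w) (hyw : y ≠ w) (hxy : x ≠ y) (hsw : s ≠ w) (hsy : s ≠ y)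
    (T : ℕ → Pat3 → Pat3 → ℤ) (D : ℕ) {ι : Type*} (J : Finset ι) (prod : ι → Prod3)
    (hcert : ∀ d : ℕ, ∀ P1 Q1 P2 Q2 P3 Q3 : Pat3,
      8 * ∑ j ∈ J, ((prod j).lam : ℤ) * (prod j).tensor d P1 Q1 P2 Q2 P3 Q3 ≤ D * target3Sym joinR3 corrR3 T d P1 Q1 P2 Q2 P3 Q3)
    (hval : ∀ j ∈ J, ∀ μ : ℕ, 0 ≤ lev2 E₁ x w s (prod j).gK μ ∧ 0 ≤ lev2 E₂ w y y (prod j).g1 μ ∧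
      0 ≤ lev2 (∅ : Finset (Sym2 V)) x w s (prod j).g2 μ)
    (lam : ℕ) : 0 ≤ (D : ℤ) * lev2 (E₁ ∪ E₂) x y s T lam :=
  cone3_level_nonneg_sym (EK := E₁) (E₁ := E₂) (E₂ := (∅ : Finset (Sym2 V))) (uK := x) (vK := w) (mK := s)
    (u₁ := w) (v₁ := y) (m₁ := y) (u₂ := x) (v₂ := w) (m₂ := s) joinR3 corrR3 (4 * Fintype.card V)
    (fun wt tab => hdec_cut1 hd h₁ h₂ hS hxV hsV hyV hxw hyw hxy hsw hsy wt tab) T D J prod hcert hval lam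

omit [Fintype V] in
/-- The bit indicators are levelwise nonnegative on any piece. [folklore] -/
theorem lev2_bitTab_nonneg (β β' : Bool) (E : Finset (Sym2 V)) (x y s : V) (μ : ℕ) : 0 ≤ lev2 E x y s (bitTab β β') μ :=
  lev2_nonneg_of_mval2 (fun _ hw => mval2_nonneg_of_coef (fun c P Q => by unfold bitTab; split_ifs <;> norm_num) hw) μ

omit [Fintype V] in
/-- The mixed bit indicator is levelwise nonnegative on any piece. [folklore] -/
theorem lev2_bitMix_nonneg (E : Finset (Sym2 V)) (x y s : V) (μ : ℕ) : 0 ≤ lev2 E x y s bitMix μ :=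
  lev2_nonneg_of_mval2 (fun _ hw => mval2_nonneg_of_coef (fun c P Q => by unfold bitMix; split_ifs <;> norm_num) hw) μ

omit [Fintype V] in
/-- Flip-orbit indicators are levelwise nonnegative on any piece. [folklore] -/
theorem lev2_orbTab_nonneg (P₀ Q₀ : Pat3) (E : Finset (Sym2 V)) (x y s : V) (μ : ℕ) : 0 ≤ lev2 E x y s (orbTab P₀ Q₀) μ :=
  lev2_nonneg_of_mval2 (fun _ hw => mval2_nonneg_of_coef (fun c P Q => by unfold orbTab; split_ifs <;> norm_num) hw) μ

end CutOne

end FK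

end Summit.CriticalPhenomena.PercolationContinuityZ3.Theorems

end
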